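import Mathlib
import Literature.Algebra.EuclideanLattices.ResidueClassLatticePointCountingProofs
import HarnessLib

/-!
# Integer points of a residue class in an expanding ellipse

Topic `Literature/Algebra/EuclideanLattices` (geometry of numbers). Everything in this file is
PROVED (theorems only).

For a positive definite binary quadratic form `Q(x) = A x₀² + B x₀x₁ + C x₁²` (`A > 0`,
`D = 4AC − B² > 0`) the ellipse `{Q ≤ c}` has area `2πc/√D`, and its boundary is the Lipschitz
image of `[0, 1]` (a circle through the square root of `Q`). Davenport's lemma in a residue class
(`abs_ncard_congr_sub_volume_le_of_forall_patch`, the tree's Lipschitz-principle count) then gives,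
for every modulus `q ≥ 1` and every `ξ ∈ ℤ²`,

  `|#{z ∈ ℤ² : z ≡ ξ (mod q), Q(z) ≤ c} − (2π/√D) c/q²| ≤ K (√c + 1)`   (`c > 0`)

with `K` depending only on `A, B, C` (`abs_ncard_congr_binQF_le_sub_le`), hence
`#{z ≡ ξ (mod q) : Q(z) ≤ c} / c → 2π/(√D q²)` (`tendsto_ncard_congr_binQF_le_div`). This is the
input for counting *primitive* vectors in a residue class (`CoprimeLatticePointsEllipse.lean`),
itself the lattice-point engine behind the asymptotic count of rational points of bounded height
on a conic (Browning–Van Valckenborgh 2012, Theorem 1, in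
`Literature/NumberTheory/DiophantineGeometry/`).

The quadratic form is passed as a function `Q` together with the hypothesis
`hQ : ∀ x, Q x = A * x 0 ^ 2 + B * (x 0 * x 1) + C * x 1 ^ 2` (no new definition).

## References

* H. Davenport, *On a principle of Lipschitz*, J. London Math. Soc. 26 (1951) 179–183
  [Davenport1951] (the counting principle; here through the tree's
  `Literature.Algebra.EuclideanLattices.abs_ncard_congr_sub_volume_le_of_forall_patch`).
-/

noncomputable section

open Set MeasureTheory Metric Filter Topology
open scoped Pointwise

namespace Literature.Algebra.EuclideanLattices

section Ellipse

variable {A B C : ℝ} {Q : (Fin 2 → ℝ) → ℝ}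

/-! ## The form `Q = A x₀² + B x₀x₁ + C x₁²`: algebra -/

/-- Homogeneity: `Q(r x) = r² Q(x)`. [folklore] -/
theorem binQF_smul (hQ : ∀ x, Q x = A * x 0 ^ 2 + B * (x 0 * x 1) + C * x 1 ^ 2) (r : ℝ)
    (x : Fin 2 → ℝ) : Q (r • x) = r ^ 2 * Q x := by
  simp only [hQ, Pi.smul_apply, smul_eq_mul]
  ring

/-- `Q` is continuous. [folklore] -/
theorem binQF_continuous (hQ : ∀ x, Q x = A * x 0 ^ 2 + B * (x 0 * x 1) + C * x 1 ^ 2) :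
    Continuous Q := by
  rw [show Q = fun x => A * x 0 ^ 2 + B * (x 0 * x 1) + C * x 1 ^ 2 from funext hQ]
  fun_prop

/-- Completing the square in `x₀`: `4A·Q(x) = (2A x₀ + B x₁)² + (4AC − B²) x₁²`. [folklore] -/
theorem four_mul_binQF (hQ : ∀ x, Q x = A * x 0 ^ 2 + B * (x 0 * x 1) + C * x 1 ^ 2)
    (x : Fin 2 → ℝ) :
    4 * A * Q x = (2 * A * x 0 + B * x 1) ^ 2 + (4 * A * C - B ^ 2) * x 1 ^ 2 := by
  rw [hQ]; ring

/-- Completing the square in `x₁`: `4C·Q(x) = (2C x₁ + B x₀)² + (4AC − B²) x₀²`. [folklore] -/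
theorem four_mul_binQF' (hQ : ∀ x, Q x = A * x 0 ^ 2 + B * (x 0 * x 1) + C * x 1 ^ 2)
    (x : Fin 2 → ℝ) :
    4 * C * Q x = (2 * C * x 1 + B * x 0) ^ 2 + (4 * A * C - B ^ 2) * x 0 ^ 2 := by
  rw [hQ]; ring

/-- `A > 0` and `4AC − B² > 0` force `C > 0`. [folklore] -/
theorem binQF_pos_C (hA : 0 < A) (hD : 0 < 4 * A * C - B ^ 2) : 0 < C := by
  nlinarith [sq_nonneg B]

/-- **Positive definiteness, quantitatively**: with `m = min(D/(4A), D/(4C))` one has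
`m · xᵢ² ≤ Q(x)` for both coordinates. [folklore] -/
theorem binQF_coord_sq_le (hQ : ∀ x, Q x = A * x 0 ^ 2 + B * (x 0 * x 1) + C * x 1 ^ 2)
    (hA : 0 < A) (hD : 0 < 4 * A * C - B ^ 2) (x : Fin 2 → ℝ) (i : Fin 2) :
    min ((4 * A * C - B ^ 2) / (4 * A)) ((4 * A * C - B ^ 2) / (4 * C)) * x i ^ 2 ≤ Q x := by
  have hC := binQF_pos_C hA hD
  have h0 : (4 * A * C - B ^ 2) / (4 * C) * x 0 ^ 2 ≤ Q x := by
    rw [div_mul_eq_mul_div, div_le_iff₀ (by positivity)]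
    nlinarith [four_mul_binQF' hQ x, sq_nonneg (2 * C * x 1 + B * x 0)]
  have h1 : (4 * A * C - B ^ 2) / (4 * A) * x 1 ^ 2 ≤ Q x := by
    rw [div_mul_eq_mul_div, div_le_iff₀ (by positivity)]
    nlinarith [four_mul_binQF hQ x, sq_nonneg (2 * A * x 0 + B * x 1)]
  fin_cases i
  · exact le_trans (mul_le_mul_of_nonneg_right (min_le_right _ _) (sq_nonneg _)) h0
  · exact le_trans (mul_le_mul_of_nonneg_right (min_le_left _ _) (sq_nonneg _)) h1

/-- The constant `m = min(D/(4A), D/(4C))` is positive. [folklore] -/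
theorem binQF_min_pos (hA : 0 < A) (hD : 0 < 4 * A * C - B ^ 2) :
    0 < min ((4 * A * C - B ^ 2) / (4 * A)) ((4 * A * C - B ^ 2) / (4 * C)) := by
  have hC := binQF_pos_C hA hD
  exact lt_min (by positivity) (by positivity)

/-- `Q ≥ 0`. [folklore] -/
theorem binQF_nonneg (hQ : ∀ x, Q x = A * x 0 ^ 2 + B * (x 0 * x 1) + C * x 1 ^ 2)
    (hA : 0 < A) (hD : 0 < 4 * A * C - B ^ 2) (x : Fin 2 → ℝ) : 0 ≤ Q x :=
  le_trans (mul_nonneg (binQF_min_pos hA hD).le (sq_nonneg (x 0))) (binQF_coord_sq_le hQ hA hD x 0)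

/-- Points of the ellipse `{Q ≤ c}` have coordinates `|xᵢ| ≤ √(c/m)`. [folklore] -/
theorem abs_coord_le_of_binQF_le (hQ : ∀ x, Q x = A * x 0 ^ 2 + B * (x 0 * x 1) + C * x 1 ^ 2)
    (hA : 0 < A) (hD : 0 < 4 * A * C - B ^ 2) {x : Fin 2 → ℝ} {c : ℝ} (hx : Q x ≤ c)
    (i : Fin 2) :
    |x i| ≤ Real.sqrt (c / min ((4 * A * C - B ^ 2) / (4 * A)) ((4 * A * C - B ^ 2) / (4 * C))) := by
  have hm := binQF_min_pos hA hD
  apply Real.abs_le_sqrt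
  rw [le_div_iff₀ hm, mul_comm]
  exact (binQF_coord_sq_le hQ hA hD x i).trans hx

/-- The ellipse `{Q ≤ c}` is bounded. [folklore] -/
theorem isBounded_binQF_le (hQ : ∀ x, Q x = A * x 0 ^ 2 + B * (x 0 * x 1) + C * x 1 ^ 2)
    (hA : 0 < A) (hD : 0 < 4 * A * C - B ^ 2) (c : ℝ) : Bornology.IsBounded {x | Q x ≤ c} := by
  refine (isBounded_closedBall (x := (0 : Fin 2 → ℝ))
    (r := Real.sqrt (c / min ((4 * A * C - B ^ 2) / (4 * A))
      ((4 * A * C - B ^ 2) / (4 * C))))).subset fun x hx => ?_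
  rw [mem_closedBall, dist_zero_right, pi_norm_le_iff_of_nonneg (Real.sqrt_nonneg _)]
  intro i
  rw [Real.norm_eq_abs]
  exact abs_coord_le_of_binQF_le hQ hA hD hx i

/-- Scaling the ellipse: `{Q ≤ c} = √c • {Q ≤ 1}` for `c > 0`. [folklore] -/
theorem setOf_binQF_le_eq_smul (hQ : ∀ x, Q x = A * x 0 ^ 2 + B * (x 0 * x 1) + C * x 1 ^ 2)
    {c : ℝ} (hc : 0 < c) : {x | Q x ≤ c} = Real.sqrt c • {x | Q x ≤ 1} := by
  have hs : 0 < Real.sqrt c := Real.sqrt_pos.2 hc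
  ext x
  rw [Set.mem_smul_set_iff_inv_smul_mem₀ hs.ne', Set.mem_setOf_eq, Set.mem_setOf_eq,
    binQF_smul hQ, inv_pow, Real.sq_sqrt hc.le, inv_mul_le_iff₀ hc, mul_one]

/-! ## The boundary circle: a Lipschitz patch `[0,1] → {Q = 1}` -/

/-- A point of the unit circle is `(cos 2πθ, sin 2πθ)` for some `θ ∈ [0, 1]`. [folklore] -/
theorem exists_cos_sin_of_sq_add_sq_eq_one {u w : ℝ} (h : u ^ 2 + w ^ 2 = 1) :
    ∃ θ : ℝ, θ ∈ Icc (0 : ℝ) 1 ∧ Real.cos (2 * Real.pi * θ) = u ∧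
      Real.sin (2 * Real.pi * θ) = w := by
  have hnorm : ‖(⟨u, w⟩ : ℂ)‖ = 1 := by
    rw [Complex.norm_eq_sqrt_sq_add_sq, h, Real.sqrt_one]
  obtain ⟨t, ht⟩ := (Complex.norm_eq_one_iff _).1 hnorm
  have hre : Real.cos t = u := by
    have := congr_arg Complex.re ht
    rwa [Complex.exp_ofReal_mul_I_re] at this
  have him : Real.sin t = w := by
    have := congr_arg Complex.im ht
    rwa [Complex.exp_ofReal_mul_I_im] at this
  refine ⟨Int.fract (t / (2 * Real.pi)), ⟨Int.fract_nonneg _, (Int.fract_lt_one _).le⟩, ?_, ?_⟩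
  · rw [Int.fract, mul_sub, mul_div_cancel₀ _ (by positivity), ← hre,
      show 2 * Real.pi * (⌊t / (2 * Real.pi)⌋ : ℝ) = (⌊t / (2 * Real.pi)⌋ : ℝ) * (2 * Real.pi) by
        ring]
    exact Real.cos_sub_int_mul_two_pi t _
  · rw [Int.fract, mul_sub, mul_div_cancel₀ _ (by positivity), ← him,
      show 2 * Real.pi * (⌊t / (2 * Real.pi)⌋ : ℝ) = (⌊t / (2 * Real.pi)⌋ : ℝ) * (2 * Real.pi) by
        ring]
    exact Real.sin_sub_int_mul_two_pi t _

/-- `|c₁ p + c₂ r| ≤ (|c₁| + |c₂|) δ` when `|p|, |r| ≤ δ`. [folklore] -/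
theorem abs_lin_comb_le {c₁ c₂ p r δ : ℝ} (hp : |p| ≤ δ) (hr : |r| ≤ δ) :
    |c₁ * p + c₂ * r| ≤ (|c₁| + |c₂|) * δ := by
  calc |c₁ * p + c₂ * r| ≤ |c₁ * p| + |c₂ * r| := abs_add_le _ _
    _ = |c₁| * |p| + |c₂| * |r| := by rw [abs_mul, abs_mul]
    _ ≤ |c₁| * δ + |c₂| * δ := add_le_add (mul_le_mul_of_nonneg_left hp (abs_nonneg _))
        (mul_le_mul_of_nonneg_left hr (abs_nonneg _))
    _ = (|c₁| + |c₂|) * δ := by ring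

/-- **The boundary patch.** With `D = 4AC − B²`, the map
`φ(θ) = (cos(2πθ)/√A − B sin(2πθ)/(√A√D), 2√A sin(2πθ)/√D)` sends `[0,1]` onto the ellipse
`{Q = 1}` and is coordinatewise Lipschitz with constant
`L = 2π (1/√A + |B|/(√A√D) + 2√A/√D)`. [folklore] -/
theorem binQF_boundary_patch (hQ : ∀ x, Q x = A * x 0 ^ 2 + B * (x 0 * x 1) + C * x 1 ^ 2)
    (hA : 0 < A) (hD : 0 < 4 * A * C - B ^ 2) :
    ∃ (φ : (Fin 1 → ℝ) → (Fin 2 → ℝ)) (L : ℝ), 0 ≤ L ∧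
      (∀ θ ∈ Icc (0 : Fin 1 → ℝ) 1, ∀ θ' ∈ Icc (0 : Fin 1 → ℝ) 1, ∀ i,
        |φ θ i - φ θ' i| ≤ L * dist θ θ') ∧
      {x | Q x = 1} ⊆ φ '' Icc (0 : Fin 1 → ℝ) 1 := by
  set sA := Real.sqrt A with hsA
  set sD := Real.sqrt (4 * A * C - B ^ 2) with hsD
  have hsA0 : 0 < sA := Real.sqrt_pos.2 hA
  have hsD0 : 0 < sD := Real.sqrt_pos.2 hD
  have hsA2 : sA ^ 2 = A := Real.sq_sqrt hA.le
  have hsD2 : sD ^ 2 = 4 * A * C - B ^ 2 := Real.sq_sqrt hD.le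
  have hQ' : ∀ x, Q x = sA ^ 2 * x 0 ^ 2 + B * (x 0 * x 1) +
      (sD ^ 2 + B ^ 2) / (4 * sA ^ 2) * x 1 ^ 2 := by
    intro x
    rw [hQ, hsA2, hsD2]
    field_simp
    ring
  set φ : (Fin 1 → ℝ) → (Fin 2 → ℝ) := fun θ =>
    ![Real.cos (2 * Real.pi * θ 0) / sA - B * Real.sin (2 * Real.pi * θ 0) / (sA * sD),
      2 * sA * Real.sin (2 * Real.pi * θ 0) / sD] with hφ
  set L : ℝ := 2 * Real.pi * (1 / sA + |B| / (sA * sD) + 2 * sA / sD) with hL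
  refine ⟨φ, L, by positivity, ?_, ?_⟩
  · intro θ _ θ' _ i
    set a := 2 * Real.pi * θ 0 with ha
    set b := 2 * Real.pi * θ' 0 with hb
    have hd : 0 ≤ dist θ θ' := dist_nonneg
    have hab : |a - b| ≤ 2 * Real.pi * dist θ θ' := by
      rw [show a - b = 2 * Real.pi * (θ 0 - θ' 0) by rw [ha, hb]; ring, abs_mul,
        abs_of_pos (by positivity : (0 : ℝ) < 2 * Real.pi)]
      exact mul_le_mul_of_nonneg_left (by rw [← Real.dist_eq]; exact dist_le_pi_dist θ θ' 0)
        (by positivity)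
    have hc : |Real.cos a - Real.cos b| ≤ 2 * Real.pi * dist θ θ' :=
      (Real.abs_cos_sub_cos_le a b).trans hab
    have hs : |Real.sin a - Real.sin b| ≤ 2 * Real.pi * dist θ θ' :=
      (Real.abs_sin_sub_sin_le a b).trans hab
    fin_cases i
    · have e : φ θ 0 - φ θ' 0 =
          (1 / sA) * (Real.cos a - Real.cos b) + (-(B / (sA * sD))) * (Real.sin a - Real.sin b) := by
        simp only [hφ, Matrix.cons_val_zero]
        ring
      show |φ θ 0 - φ θ' 0| ≤ L * dist θ θ'
      rw [e]
      refine (abs_lin_comb_le hc hs).trans ?_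
      rw [abs_neg, abs_of_pos (one_div_pos.2 hsA0), abs_div, abs_of_pos (mul_pos hsA0 hsD0)]
      have : L * dist θ θ' - (1 / sA + |B| / (sA * sD)) * (2 * Real.pi * dist θ θ') =
          2 * Real.pi * (2 * sA / sD) * dist θ θ' := by rw [hL]; ring
      nlinarith [this, (by positivity : (0 : ℝ) ≤ 2 * Real.pi * (2 * sA / sD) * dist θ θ')]
    · have e : φ θ 1 - φ θ' 1 =
          0 * (Real.cos a - Real.cos b) + (2 * sA / sD) * (Real.sin a - Real.sin b) := by
        simp only [hφ, Matrix.cons_val_one, Matrix.cons_val_zero]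
        ring
      show |φ θ 1 - φ θ' 1| ≤ L * dist θ θ'
      rw [e]
      refine (abs_lin_comb_le hc hs).trans ?_
      rw [abs_zero, abs_of_pos (by positivity : (0 : ℝ) < 2 * sA / sD)]
      have : L * dist θ θ' - (0 + 2 * sA / sD) * (2 * Real.pi * dist θ θ') =
          2 * Real.pi * (1 / sA + |B| / (sA * sD)) * dist θ θ' := by rw [hL]; ring
      nlinarith [this,
        (by positivity : (0 : ℝ) ≤ 2 * Real.pi * (1 / sA + |B| / (sA * sD)) * dist θ θ')]
  · intro x hx
    rw [Set.mem_setOf_eq] at hx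
    set u := sA * x 0 + B / (2 * sA) * x 1 with hu
    set w := sD / (2 * sA) * x 1 with hw
    have huw : u ^ 2 + w ^ 2 = 1 := by
      rw [← hx, hQ' x, hu, hw]
      field_simp
      ring
    obtain ⟨θ, hθ, hcos, hsin⟩ := exists_cos_sin_of_sq_add_sq_eq_one huw
    refine ⟨fun _ => θ, ⟨fun _ => hθ.1, fun _ => hθ.2⟩, ?_⟩
    funext i
    fin_cases i
    · show φ (fun _ => θ) 0 = x 0
      simp only [hφ, Matrix.cons_val_zero, hcos, hsin, hu, hw]
      field_simp
      ring
    · show φ (fun _ => θ) 1 = x 1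
      simp only [hφ, Matrix.cons_val_one, Matrix.cons_val_zero, hsin, hw]
      field_simp

/-- **The frontier of the ellipse `{Q ≤ c}` (`c > 0`) is covered by one Lipschitz patch** with
coordinatewise constant `√c · L`. [folklore] -/
theorem binQF_frontier_patch (hQ : ∀ x, Q x = A * x 0 ^ 2 + B * (x 0 * x 1) + C * x 1 ^ 2)
    (hA : 0 < A) (hD : 0 < 4 * A * C - B ^ 2) :
    ∃ (φ : (Fin 1 → ℝ) → (Fin 2 → ℝ)) (L : ℝ), 0 ≤ L ∧
      (∀ θ ∈ Icc (0 : Fin 1 → ℝ) 1, ∀ θ' ∈ Icc (0 : Fin 1 → ℝ) 1, ∀ i,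
        |φ θ i - φ θ' i| ≤ L * dist θ θ') ∧
      ∀ c : ℝ, 0 < c →
        frontier {x | Q x ≤ c} ⊆ ⋃ _p : Unit, (fun θ => Real.sqrt c • φ θ) '' Icc (0 : Fin 1 → ℝ) 1 := by
  obtain ⟨φ, L, hL, hφ, hcov⟩ := binQF_boundary_patch hQ hA hD
  refine ⟨φ, L, hL, hφ, fun c hc => ?_⟩
  have hs : 0 < Real.sqrt c := Real.sqrt_pos.2 hc
  intro x hx
  have hx' : Q x = c := frontier_le_subset_eq (binQF_continuous hQ) continuous_const hx
  have hy : Q ((Real.sqrt c)⁻¹ • x) = 1 := by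
    rw [binQF_smul hQ, hx', inv_pow, Real.sq_sqrt hc.le, inv_mul_cancel₀ hc.ne']
  obtain ⟨θ, hθ, hθx⟩ := hcov hy
  simp only [Set.mem_iUnion, Set.mem_image]
  exact ⟨(), θ, hθ, by rw [hθx, smul_inv_smul₀ hs.ne']⟩

/-! ## The area of the ellipse -/

/-- The unit disc of `ℝ²` (coordinates `Fin 2 → ℝ`) has Lebesgue measure `π`. [folklore] -/
theorem volume_setOf_sq_add_sq_le_one :
    volume {y : Fin 2 → ℝ | y 0 ^ 2 + y 1 ^ 2 ≤ 1} = ENNReal.ofReal Real.pi := by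
  have hset : {y : Fin 2 → ℝ | y 0 ^ 2 + y 1 ^ 2 ≤ 1} =
      (WithLp.toLp 2 : (Fin 2 → ℝ) → EuclideanSpace ℝ (Fin 2)) ⁻¹'
        closedBall (0 : EuclideanSpace ℝ (Fin 2)) 1 := by
    ext y
    rw [Set.mem_preimage, mem_closedBall, dist_zero_right, Set.mem_setOf_eq,
      ← sq_le_one_iff₀ (norm_nonneg _), EuclideanSpace.real_norm_sq_eq, Fin.sum_univ_two]
  rw [hset, (PiLp.volume_preserving_toLp (Fin 2)).measure_preimage
    measurableSet_closedBall.nullMeasurableSet, EuclideanSpace.volume_closedBall_fin_two]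
  simp

/-- **Area of the ellipse**: `vol {Q ≤ 1} = 2π/√D`, `D = 4AC − B²`. The ellipse is the
preimage of the unit disc under `x ↦ (√A x₀ + B x₁/(2√A), √D x₁/(2√A))`, of determinant
`√D/2`. [folklore] -/
theorem volume_binQF_le_one (hQ : ∀ x, Q x = A * x 0 ^ 2 + B * (x 0 * x 1) + C * x 1 ^ 2)
    (hA : 0 < A) (hD : 0 < 4 * A * C - B ^ 2) :
    volume {x | Q x ≤ 1} = ENNReal.ofReal (2 * Real.pi / Real.sqrt (4 * A * C - B ^ 2)) := by
  set sA := Real.sqrt A with hsA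
  set sD := Real.sqrt (4 * A * C - B ^ 2) with hsD
  have hsA0 : 0 < sA := Real.sqrt_pos.2 hA
  have hsD0 : 0 < sD := Real.sqrt_pos.2 hD
  have hsA2 : sA ^ 2 = A := Real.sq_sqrt hA.le
  have hsD2 : sD ^ 2 = 4 * A * C - B ^ 2 := Real.sq_sqrt hD.le
  have hQ' : ∀ x, Q x = sA ^ 2 * x 0 ^ 2 + B * (x 0 * x 1) +
      (sD ^ 2 + B ^ 2) / (4 * sA ^ 2) * x 1 ^ 2 := by
    intro x
    rw [hQ, hsA2, hsD2]
    field_simp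
    ring
  set T : (Fin 2 → ℝ) →ₗ[ℝ] (Fin 2 → ℝ) := Matrix.toLin' !![sA, B / (2 * sA); 0, sD / (2 * sA)]
    with hT
  have hT0 : ∀ x, T x 0 = sA * x 0 + B / (2 * sA) * x 1 := fun x => by
    simp [hT, Matrix.toLin'_apply, Matrix.mulVec, dotProduct, Fin.sum_univ_two]
  have hT1 : ∀ x, T x 1 = sD / (2 * sA) * x 1 := fun x => by
    simp [hT, Matrix.toLin'_apply, Matrix.mulVec, dotProduct, Fin.sum_univ_two]
  have hdet : LinearMap.det T = sD / 2 := by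
    rw [hT, LinearMap.det_toLin', Matrix.det_fin_two_of]
    field_simp
    ring
  have hset : {x | Q x ≤ 1} = T ⁻¹' {y : Fin 2 → ℝ | y 0 ^ 2 + y 1 ^ 2 ≤ 1} := by
    ext x
    simp only [Set.mem_setOf_eq, Set.mem_preimage, hT0, hT1, hQ']
    have : (sA * x 0 + B / (2 * sA) * x 1) ^ 2 + (sD / (2 * sA) * x 1) ^ 2 =
        sA ^ 2 * x 0 ^ 2 + B * (x 0 * x 1) + (sD ^ 2 + B ^ 2) / (4 * sA ^ 2) * x 1 ^ 2 := by
      field_simp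
      ring
    rw [this]
  rw [hset, Measure.addHaar_preimage_linearMap _ (by rw [hdet]; positivity),
    volume_setOf_sq_add_sq_le_one, hdet, ← ENNReal.ofReal_mul (by positivity)]
  congr 1
  rw [abs_of_pos (by positivity)]
  field_simp

/-- `vol {Q ≤ c} = (2π/√D) c` for `c > 0`. [folklore] -/
theorem volume_real_binQF_le (hQ : ∀ x, Q x = A * x 0 ^ 2 + B * (x 0 * x 1) + C * x 1 ^ 2)
    (hA : 0 < A) (hD : 0 < 4 * A * C - B ^ 2) {c : ℝ} (hc : 0 < c) :
    volume.real {x | Q x ≤ c} = 2 * Real.pi / Real.sqrt (4 * A * C - B ^ 2) * c := by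
  rw [measureReal_def, setOf_binQF_le_eq_smul hQ hc,
    Measure.addHaar_smul_of_nonneg _ (Real.sqrt_nonneg c), volume_binQF_le_one hQ hA hD,
    Module.finrank_fin_fun, Real.sq_sqrt hc.le, ← ENNReal.ofReal_mul hc.le,
    ENNReal.toReal_ofReal (by positivity)]
  ring

/-! ## Counting a residue class in the ellipse -/

/-- **Integer points `z ≡ ξ (mod q)` in the ellipse `{Q ≤ c}`**: there is `K = K(A, B, C)`
with `|#{z ∈ ℤ² : z ≡ ξ (mod q), Q(z) ≤ c} − (2π/√D) c/q²| ≤ K (√c + 1)` for all `c > 0`,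
`q ≥ 1`, `ξ ∈ ℤ²` (Davenport's lemma in a residue class with the boundary patch above and
`N = ⌊√c⌋ + 1` subdivisions). [cite: Davenport1951, Theorem (principle of Lipschitz)] -/
theorem abs_ncard_congr_binQF_le_sub_le
    (hQ : ∀ x, Q x = A * x 0 ^ 2 + B * (x 0 * x 1) + C * x 1 ^ 2)
    (hA : 0 < A) (hD : 0 < 4 * A * C - B ^ 2) :
    ∃ K : ℝ, 0 ≤ K ∧ ∀ (q : ℕ), 0 < q → ∀ (ξ : Fin 2 → ℤ) (c : ℝ), 0 < c →
      |({z : Fin 2 → ℤ | (∀ i, (q : ℤ) ∣ z i - ξ i) ∧ Q (intPt z) ≤ c}.ncard : ℝ) -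
          2 * Real.pi / Real.sqrt (4 * A * C - B ^ 2) * c / (q : ℝ) ^ 2| ≤
        K * (Real.sqrt c + 1) := by
  obtain ⟨φ, L, hL, hφ, hcov⟩ := binQF_frontier_patch hQ hA hD
  refine ⟨(2 * L + 2) ^ 2, by positivity, fun q hq ξ c hc => ?_⟩
  have hs : 0 ≤ Real.sqrt c := Real.sqrt_nonneg c
  set N : ℕ := ⌊Real.sqrt c⌋₊ + 1 with hN
  have hN0 : 0 < N := Nat.succ_pos _
  have hNs : Real.sqrt c ≤ N := by
    rw [hN]; push_cast; exact (Nat.lt_floor_add_one _).le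
  have hNs' : (N : ℝ) ≤ Real.sqrt c + 1 := by
    rw [hN]; push_cast; linarith [Nat.floor_le hs]
  have hφ' : ∀ _p : Unit, ∀ θ ∈ Icc (0 : Fin 1 → ℝ) 1, ∀ θ' ∈ Icc (0 : Fin 1 → ℝ) 1, ∀ i,
      |(fun θ => Real.sqrt c • φ θ) θ i - (fun θ => Real.sqrt c • φ θ) θ' i| ≤
        (fun (_ : Unit) (_ : Fin 2) => Real.sqrt c * L) () i * dist θ θ' := by
    intro _ θ hθ θ' hθ' i
    simp only [Pi.smul_apply, smul_eq_mul]
    rw [← mul_sub, abs_mul, abs_of_nonneg hs, mul_assoc]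
    exact mul_le_mul_of_nonneg_left (hφ θ hθ θ' hθ' i) hs
  have h := abs_ncard_congr_sub_volume_le_of_forall_patch (isBounded_binQF_le hQ hA hD c)
    (P := Unit) (fun _ θ => Real.sqrt c • φ θ) (fun _ _ => Real.sqrt c * L)
    (fun _ _ => by positivity) hφ' (fun _ => N) (fun _ => hN0) (hcov c hc) hq ξ
  rw [volume_real_binQF_le hQ hA hD hc] at h
  simp only [Finset.univ_unique, Finset.sum_singleton, pow_one, Fin.prod_univ_two] at h
  refine h.trans ?_
  have hq' : (1 : ℝ) ≤ q := by exact_mod_cast hq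
  have hN' : (0 : ℝ) < N := by exact_mod_cast hN0
  have key : 2 * (Real.sqrt c * L) / (q * N) + 2 ≤ 2 * L + 2 := by
    have h1 : 2 * (Real.sqrt c * L) / (q * N) ≤ 2 * L := by
      rw [div_le_iff₀ (by positivity)]
      have : Real.sqrt c * L ≤ L * (q * N) := by
        calc Real.sqrt c * L ≤ N * L := mul_le_mul_of_nonneg_right hNs hL
          _ = L * (1 * N) := by ring
          _ ≤ L * (q * N) := by gcongr
      linarith
    linarith
  have hpos : 0 ≤ 2 * (Real.sqrt c * L) / (q * N) + 2 := by positivity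
  calc (N : ℝ) * ((2 * (Real.sqrt c * L) / (q * N) + 2) * (2 * (Real.sqrt c * L) / (q * N) + 2))
      ≤ (Real.sqrt c + 1) * ((2 * L + 2) * (2 * L + 2)) := by
        apply mul_le_mul hNs' (mul_le_mul key key hpos (by positivity)) (by positivity)
          (by positivity)
    _ = (2 * L + 2) ^ 2 * (Real.sqrt c + 1) := by ring

/-- **Asymptotic density of a residue class in the ellipse**:
`#{z ∈ ℤ² : z ≡ ξ (mod q), Q(z) ≤ c} / c → 2π/(√D q²)` as `c → ∞`. [folklore] -/
theorem tendsto_ncard_congr_binQF_le_div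
    (hQ : ∀ x, Q x = A * x 0 ^ 2 + B * (x 0 * x 1) + C * x 1 ^ 2)
    (hA : 0 < A) (hD : 0 < 4 * A * C - B ^ 2) {q : ℕ} (hq : 0 < q) (ξ : Fin 2 → ℤ) :
    Tendsto (fun c : ℝ =>
      ({z : Fin 2 → ℤ | (∀ i, (q : ℤ) ∣ z i - ξ i) ∧ Q (intPt z) ≤ c}.ncard : ℝ) / c) atTop
      (𝓝 (2 * Real.pi / Real.sqrt (4 * A * C - B ^ 2) / (q : ℝ) ^ 2)) := by
  obtain ⟨K, hK, hcount⟩ := abs_ncard_congr_binQF_le_sub_le hQ hA hD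
  set κ : ℝ := 2 * Real.pi / Real.sqrt (4 * A * C - B ^ 2) / (q : ℝ) ^ 2 with hκ
  -- the error `K (√c + 1) / c → 0`
  have herr : Tendsto (fun c : ℝ => K * (Real.sqrt c + 1) / c) atTop (𝓝 0) := by
    have e : ∀ c : ℝ, 0 < c → K * (Real.sqrt c + 1) / c = K * (Real.sqrt c)⁻¹ + K * c⁻¹ := by
      intro c _
      calc K * (Real.sqrt c + 1) / c = K * (Real.sqrt c / c) + K * c⁻¹ := by ring
        _ = K * (Real.sqrt c)⁻¹ + K * c⁻¹ := by rw [Real.sqrt_div_self', one_div]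
    have h1 : Tendsto (fun c : ℝ => K * (Real.sqrt c)⁻¹ + K * c⁻¹) atTop (𝓝 (K * 0 + K * 0)) :=
      ((tendsto_inv_atTop_zero.comp Real.tendsto_sqrt_atTop).const_mul K).add
        (tendsto_inv_atTop_zero.const_mul K)
    rw [mul_zero, add_zero] at h1
    exact h1.congr' (by filter_upwards [eventually_gt_atTop 0] with c hc using (e c hc).symm)
  rw [show κ = 0 + κ by ring]
  refine Tendsto.add_const κ (f := fun c : ℝ =>
    ({z : Fin 2 → ℤ | (∀ i, (q : ℤ) ∣ z i - ξ i) ∧ Q (intPt z) ≤ c}.ncard : ℝ) / c - κ) ?_ |>.congr ?_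
  · refine squeeze_zero_norm' ?_ herr
    filter_upwards [eventually_gt_atTop 0] with c hc
    have h := hcount q hq ξ c hc
    rw [Real.norm_eq_abs]
    have : ({z : Fin 2 → ℤ | (∀ i, (q : ℤ) ∣ z i - ξ i) ∧ Q (intPt z) ≤ c}.ncard : ℝ) / c - κ =
        ((({z : Fin 2 → ℤ | (∀ i, (q : ℤ) ∣ z i - ξ i) ∧ Q (intPt z) ≤ c}.ncard : ℝ) -
          2 * Real.pi / Real.sqrt (4 * A * C - B ^ 2) * c / (q : ℝ) ^ 2)) / c := by
      rw [hκ]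
      field_simp
    rw [this, abs_div, abs_of_pos hc]
    exact div_le_div_of_nonneg_right h hc.le
  · intro c
    simp only [sub_add_cancel]

end Ellipse



end Literature.Algebra.EuclideanLattices
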